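import Summits.FinalStateConjecture.FinalStateConjecture.Theorems.PhotonSphereChannelsChannelsResolveTameDevelopmentsRTrappedSetFlatExterior
import Literature.Geometry.Lorentzian.KerrSchildLocalEnergy
import Literature.Geometry.Lorentzian.KerrDependenceWeights
import Literature.Geometry.Lorentzian.KerrWaveEnergy
import HarnessLib

/-!
# Crux `ChannelsResolveTameDevelopmentsR` (stmt-FinalStateConjecture-14075), line
# `trapped-set-observability-analyticity` — stub `stub_trappedSetObservability` (S4', reshaped):
# the first rung — FORWARD ENERGY UNIQUENESS on the flat member of the class

Stub S4' asserts `IsPresentedDarkExterior a r₀ G → TwoSidedConcentrationLawK a r₀ G`.  Every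
proof of it — already its degenerate-shell case — starts from the FORWARD energy estimate /
uniqueness on the cylinder `cyl a r₀ = {r₀ < r(a,·)}`: zero slice energy at `t₁` stays zero for
`t ≥ t₁` (the excision collar is an outflow boundary forward; nothing is claimed backward).  This
file lands that rung on the FLAT MEMBER (`G ≡ η`, `r₀ < 0`, cylinder `= E4`; membership is
p107942) by BRIDGING the line's vocabulary to the tree's Kerr–Schild wave apparatus:
§1 the line's `boxAt (fun _ ↦ η) u x = tr_η D²u(x) − Du(x)(∑_β Γ_η(♯dx^β, ∂_β))` has no
Christoffel term, equals `∑ η^{μν} ∂_μ∂_ν u(x)`, hence IS `KerrSchild.waveOperator` of the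
Minkowski background `KerrSchild.Background.minkowski` (`KerrSchildWaveCauchyProblem.lean`)
wherever `Du` is differentiable (`waveOperator_minkowski_eq_boxAt`); §2 it commutes with
translations; §3 a slice energy `∫ ∑_μ(∂_μu)²(t,y) dy` of a `C¹` function over the (open) slice
of ANY presentation cylinder vanishes iff `Du(t,·) = 0` there (`sliceEnergy_eq_zero_iff`); §4
Hawking–Ellis's conservation theorem (`KerrSchild.Background.fderiv_eq_zero_of_weight`,
`KerrSchildLocalEnergy.lean`) on the flat background with the cone weight of
`KerrDependenceWeights.lean` (flux sign = dominant energy condition, `KerrSchildDominantEnergy`):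
`Dv = 0` on `{x⁰ = 0}`, `□_η v = 0` ⇒ `Dv = 0` on `{x⁰ ≥ 0}` (`fderiv_eq_zero_of_flat_forward`);
§5 assembly; §6 the registered sub-goals `stub_boxAtMinkowskiEqWaveOperator`,
`stub_sliceEnergyEqZeroIff`, `stub_flatForwardEnergyUniqueness`.  The line's vocabulary (`cyl`,
`boxAt`, `eOne`, `sliceEnergy`) is written UNFOLDED, verbatim its bodies in
`Theorems/PhotonSphereChannelsPresentedExteriorDefs.lean` (p110780; not yet built by the farm at
check time), so the folded statements over the line's names are `Iff.rfl`-close.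
-/

set_option linter.dupNamespace false

noncomputable section

namespace Summit.FinalStateConjecture.FinalStateConjecture.Theorems.TrappedSet

open Literature.Geometry.Lorentzian
open scoped Manifold ContDiff Topology ENNReal NNReal BigOperators
open Filter Set Function TopologicalSpace MeasureTheory Metric

/-! ## §1 `□_η` in the line's vocabulary is the flat divergence-form wave operator -/

/-- `♯_η dx^ν = η^{νν} ∂_ν` (`♯_η dt = −∂_t`, `♯_η dxⁱ = ∂ᵢ`). [cite: ONeill1983, Ch. 3, p. 55] -/
theorem sharpAt_const_minkowski_dx (x : E4) (ν : Fin 4) :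
    MetricCoord.sharpAt (fun _ : E4 ↦ Minkowski.bilin) x (E4.dx ν) =
      Kerr.etaComp ν ν • E4.basisVector ν := by
  refine MetricCoord.sharpAt_eq_of_forall (G := fun _ : E4 ↦ Minkowski.bilin)
    CoordSphere.isInvertible_minkowski fun w ↦ ?_
  rw [map_smul, FunLike.coe_smul, Pi.smul_apply, smul_eq_mul]
  fin_cases ν <;> simp [Kerr.etaComp, Fin.sum_univ_three, Fin.succ_ne_zero]

/-- The inverse-metric coefficients of `η` in the coordinate basis are `diag(−1,1,1,1)`.
[cite: ONeill1983, Ch. 3, p. 55] -/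
theorem ginv_const_minkowski (x : E4) (μ ν : Fin 4) :
    MetricCoord.ginv (fun _ : E4 ↦ Minkowski.bilin) (EuclideanSpace.basisFun (Fin 4) ℝ).toBasis
      x μ ν = Kerr.etaComp μ ν := by
  have hco : MetricCoord.coordCLM (EuclideanSpace.basisFun (Fin 4) ℝ).toBasis ν = E4.dx ν := by
    ext v
    rw [MetricCoord.coordCLM_apply, Kerr.coord_basisFun]
    rfl
  unfold MetricCoord.ginv
  rw [hco, sharpAt_const_minkowski_dx, map_smul, Kerr.coord_basisFun, smul_eq_mul]
  fin_cases μ <;> fin_cases ν <;> simp [Kerr.etaComp, E4.basisVector]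

/-- **The metric trace of `η` in coordinates**: `tr_η β = ∑_{μν} η^{μν} β(∂_μ, ∂_ν)`.
[cite: ONeill1983, Ch. 3, pp. 60–61] -/
theorem mtrAt_const_minkowski (x : E4) (β : E4 →L[ℝ] E4 →L[ℝ] ℝ) :
    MetricCoord.mtrAt (fun _ : E4 ↦ Minkowski.bilin) x β =
      ∑ μ, ∑ ν, Kerr.etaComp μ ν * β (E4.basisVector μ) (E4.basisVector ν) := by
  rw [MetricCoord.mtrAt_eq_sum (EuclideanSpace.basisFun (Fin 4) ℝ).toBasis]
  refine Finset.sum_congr rfl fun μ _ ↦ Finset.sum_congr rfl fun ν _ ↦ ?_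
  rw [ginv_const_minkowski]
  simp [OrthonormalBasis.coe_toBasis, EuclideanSpace.basisFun_apply]

/-- **`□_η` has no Christoffel term**: the line's `boxAt (fun _ ↦ η) u x` (UNFOLDED, verbatim
its body `tr_G D²u(x) − Du(x)(∑_β Γ_G(♯dx^β, ∂_β))`) is `∑_{μν} η^{μν} ∂_μ∂_ν u(x) = −∂ₜ²u + Δu`
(the contracted Christoffel sum vanishes, p107942). [cite: ONeill1983, Ch. 3, Lemma 3.36] -/
theorem boxAt_const_minkowski (u : E4 → ℝ) (x : E4) :
    MetricCoord.mtrAt (fun _ : E4 ↦ Minkowski.bilin) x (fderiv ℝ (fderiv ℝ u) x) -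
        fderiv ℝ u x (∑ β : Fin 4, MetricCoord.chrAt (fun _ : E4 ↦ Minkowski.bilin) x
          (MetricCoord.sharpAt (fun _ : E4 ↦ Minkowski.bilin) x (E4.dx β)) (E4.basisVector β)) =
      ∑ μ, ∑ ν, Kerr.etaComp μ ν *
        fderiv ℝ (fderiv ℝ u) x (E4.basisVector μ) (E4.basisVector ν) := by
  rw [harmonicGauge_const_minkowski, map_zero, sub_zero, mtrAt_const_minkowski]

/-- **Bridge to the tree's wave apparatus**: wherever `Du` is differentiable (e.g. `u ∈ C²`),
the line's `boxAt (fun _ ↦ η) u x` (unfolded) IS the divergence-form wave operator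
`∑_μ ∂_μ(η^{μν} ∂_ν u)(x)` of `KerrSchild.Background.minkowski`, to which the energy estimate /
conservation theorem of `KerrSchild{EnergyEstimate,LocalEnergy}.lean` apply.
[cite: ONeill1983, Ch. 3, Lemma 3.36] -/
theorem waveOperator_minkowski_eq_boxAt {u : E4 → ℝ} {x : E4}
    (hu : DifferentiableAt ℝ (fderiv ℝ u) x) :
    KerrSchild.waveOperator KerrSchild.Background.minkowski.inverseMetric u x =
      MetricCoord.mtrAt (fun _ : E4 ↦ Minkowski.bilin) x (fderiv ℝ (fderiv ℝ u) x) -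
        fderiv ℝ u x (∑ β : Fin 4, MetricCoord.chrAt (fun _ : E4 ↦ Minkowski.bilin) x
          (MetricCoord.sharpAt (fun _ : E4 ↦ Minkowski.bilin) x (E4.dx β))
            (E4.basisVector β)) := by
  rw [boxAt_const_minkowski, KerrSchild.waveOperator_apply]
  refine Finset.sum_congr rfl fun μ _ ↦ ?_
  have hν : ∀ ν, HasFDerivAt (fun y ↦ fderiv ℝ u y (E4.basisVector ν))
      ((fderiv ℝ (fderiv ℝ u) x).flip (E4.basisVector ν)) x := fun ν ↦ by
    simpa using hu.hasFDerivAt.clm_apply (hasFDerivAt_const (E4.basisVector ν) x)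
  have hsum : HasFDerivAt
      (fun y ↦ ∑ ν, KerrSchild.Background.minkowski.inverseMetric y μ ν *
        fderiv ℝ u y (E4.basisVector ν))
      (∑ ν, Kerr.etaComp μ ν • (fderiv ℝ (fderiv ℝ u) x).flip (E4.basisVector ν)) x := by
    simp only [KerrSchild.Background.inverseMetric_minkowski]
    exact HasFDerivAt.fun_sum fun ν _ ↦ (hν ν).const_mul (Kerr.etaComp μ ν)
  rw [hsum.fderiv]
  simp [ContinuousLinearMap.flip_apply]

/-! ## §2 Time translations -/

/-- The Hessian of a translate is the translate of the Hessian. [folklore] -/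
theorem fderiv_fderiv_comp_add_right (u : E4 → ℝ) (v x : E4) :
    fderiv ℝ (fderiv ℝ (fun y ↦ u (y + v))) x = fderiv ℝ (fderiv ℝ u) (x + v) := by
  have h : fderiv ℝ (fun y ↦ u (y + v)) = fun y ↦ fderiv ℝ u (y + v) :=
    funext fun y ↦ fderiv_comp_add_right v
  rw [h, fderiv_comp_add_right]

/-- **`□_η` commutes with translations**: `□_η[u(· + v)](x) = □_η[u](x + v)`. [folklore] -/
theorem flatBox_comp_add_right (u : E4 → ℝ) (v x : E4) :
    MetricCoord.mtrAt (fun _ : E4 ↦ Minkowski.bilin) x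
          (fderiv ℝ (fderiv ℝ (fun y ↦ u (y + v))) x) -
        fderiv ℝ (fun y ↦ u (y + v)) x (∑ β : Fin 4,
          MetricCoord.chrAt (fun _ : E4 ↦ Minkowski.bilin) x
            (MetricCoord.sharpAt (fun _ : E4 ↦ Minkowski.bilin) x (E4.dx β)) (E4.basisVector β)) =
      MetricCoord.mtrAt (fun _ : E4 ↦ Minkowski.bilin) (x + v) (fderiv ℝ (fderiv ℝ u) (x + v)) -
        fderiv ℝ u (x + v) (∑ β : Fin 4,
          MetricCoord.chrAt (fun _ : E4 ↦ Minkowski.bilin) (x + v)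
            (MetricCoord.sharpAt (fun _ : E4 ↦ Minkowski.bilin) (x + v) (E4.dx β))
              (E4.basisVector β)) := by
  rw [boxAt_const_minkowski, boxAt_const_minkowski, fderiv_fderiv_comp_add_right]

/-! ## §3 A slice energy vanishes iff the differential vanishes on the slice -/
/-- `∑_μ (∂_μ u)² = 0 ↔ Du = 0` at a point. [folklore] -/
theorem sum_sq_fderiv_eq_zero_iff (u : E4 → ℝ) (x : E4) :
    ∑ μ : Fin 4, (fderiv ℝ u x (E4.basisVector μ)) ^ 2 = 0 ↔ fderiv ℝ u x = 0 := by
  refine ⟨fun hsum ↦ ?_, fun h ↦ by simp [h]⟩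
  have hμ : ∀ μ, fderiv ℝ u x (E4.basisVector μ) = 0 := fun μ ↦
    (pow_eq_zero_iff two_ne_zero).mp
      ((Finset.sum_eq_zero_iff_of_nonneg fun μ _ ↦ sq_nonneg _).mp hsum μ (Finset.mem_univ μ))
  ext w
  rw [Kerr.eq_sum_basisVector w, map_sum]
  simp [hμ]

/-- **A slice energy vanishes iff the differential vanishes on the slice**: for an open
`S ⊆ ℝ³` on which `y ↦ Du(t, y)` is continuous, `∫_S ∑_μ (∂_μ u)²(t, y) dy = 0 ↔ Du(t, ·) = 0`
on `S` (else the integrand is `> c > 0` on a ball of positive volume). [folklore] -/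
theorem setLIntegral_sliceDensity_eq_zero_iff {u : E4 → ℝ} {S : Set E3} (hS : IsOpen S) {t : ℝ}
    (hc : ContinuousOn (fun y ↦ fderiv ℝ u (E4.ofTimeSpace t y)) S) :
    (∫⁻ y in S, ENNReal.ofReal
        (∑ μ : Fin 4, (fderiv ℝ u (E4.ofTimeSpace t y) (E4.basisVector μ)) ^ 2)) = 0 ↔
      ∀ y ∈ S, fderiv ℝ u (E4.ofTimeSpace t y) = 0 := by
  set f : E3 → ℝ := fun y ↦ ∑ μ : Fin 4, (fderiv ℝ u (E4.ofTimeSpace t y) (E4.basisVector μ)) ^ 2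
    with hf
  have hfc : ContinuousOn f S :=
    continuousOn_finsetSum _ fun μ _ ↦ (hc.clm_apply continuousOn_const).pow 2
  have hf0 : ∀ y, 0 ≤ f y := fun y ↦ Finset.sum_nonneg fun μ _ ↦ sq_nonneg _
  refine ⟨fun hint y hy ↦ ?_, fun h ↦ ?_⟩
  · by_contra hne
    have hpos : 0 < f y := by
      rcases (hf0 y).eq_or_lt with h0 | h0
      · exact absurd ((sum_sq_fderiv_eq_zero_iff u _).mp h0.symm) hne
      · exact h0
    -- `f > f y / 2` on a ball inside `S`
    have hca : ContinuousAt f y := (hfc y hy).continuousAt (hS.mem_nhds hy)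
    have hev : ∀ᶠ z in 𝓝 y, f y / 2 < f z ∧ z ∈ S :=
      (continuousAt_const.eventually_lt hca (half_lt_self hpos)).and (hS.mem_nhds hy)
    obtain ⟨ρ, hρ, hball⟩ := Metric.eventually_nhds_iff_ball.mp hev
    have hlow : ENNReal.ofReal (f y / 2) * volume (ball y ρ) ≤
        ∫⁻ z in S, ENNReal.ofReal (f z) := by
      calc ENNReal.ofReal (f y / 2) * volume (ball y ρ)
          = ∫⁻ _ in ball y ρ, ENNReal.ofReal (f y / 2) := (setLIntegral_const _ _).symm
        _ ≤ ∫⁻ z in ball y ρ, ENNReal.ofReal (f z) :=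
            setLIntegral_mono' measurableSet_ball fun z hz ↦
              ENNReal.ofReal_le_ofReal (hball z hz).1.le
        _ ≤ ∫⁻ z in S, ENNReal.ofReal (f z) := lintegral_mono_set fun z hz ↦ (hball z hz).2
    have hposE : 0 < ENNReal.ofReal (f y / 2) * volume (ball y ρ) :=
      ENNReal.mul_pos (ENNReal.ofReal_pos.mpr (half_pos hpos)).ne'
        (measure_ball_pos volume y hρ).ne'
    have hint' : (∫⁻ z in S, ENNReal.ofReal (f z)) = 0 := hint
    rw [hint'] at hlow
    exact absurd (hposE.trans_le hlow) (lt_irrefl 0)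
  · refine le_antisymm ?_ (zero_le)
    calc (∫⁻ y in S, ENNReal.ofReal (f y)) ≤ ∫⁻ _ in S, (0 : ℝ≥0∞) :=
          setLIntegral_mono' hS.measurableSet fun y hy ↦ by
            have : f y = 0 := by
              rw [hf]
              exact (sum_sq_fderiv_eq_zero_iff u _).mpr (h y hy)
            rw [this, ENNReal.ofReal_zero]
      _ = 0 := by simp

/-- **Slice energy of a `C¹` function on ANY presentation cylinder: zero iff `Du` vanishes on
the slice** — the line's `sliceEnergy a r₀ u t = 0 ↔ ∀ y, (t,y) ∈ cyl a r₀ → Du(t,y) = 0`,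
UNFOLDED (verbatim bodies of `sliceEnergy`, `eOne`, `cyl`; the slice sets are open). [folklore] -/
theorem sliceEnergy_eq_zero_iff (a r₀ : ℝ) {u : E4 → ℝ}
    (hu : ContDiffOn ℝ 1 u {x : E4 | r₀ < Kerr.radius a x}) (t : ℝ) :
    (∫⁻ y in {y : E3 | E4.ofTimeSpace t y ∈ {x : E4 | r₀ < Kerr.radius a x}},
        ENNReal.ofReal
          (∑ μ : Fin 4, (fderiv ℝ u (E4.ofTimeSpace t y) (E4.basisVector μ)) ^ 2)) = 0 ↔
      ∀ y : E3, E4.ofTimeSpace t y ∈ {x : E4 | r₀ < Kerr.radius a x} →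
        fderiv ℝ u (E4.ofTimeSpace t y) = 0 := by
  have hopen : IsOpen {x : E4 | r₀ < Kerr.radius a x} :=
    isOpen_lt continuous_const (Kerr.continuous_radius a)
  have hc : ContinuousOn (fun y ↦ fderiv ℝ u (E4.ofTimeSpace t y))
      {y : E3 | E4.ofTimeSpace t y ∈ {x : E4 | r₀ < Kerr.radius a x}} :=
    (hu.continuousOn_fderiv_of_isOpen hopen le_rfl).comp
      (E4.continuous_ofTimeSpace t).continuousOn fun y hy ↦ hy
  exact setLIntegral_sliceDensity_eq_zero_iff (hopen.preimage (E4.continuous_ofTimeSpace t)) hc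

/-! ## §4 The conservation theorem on the flat background: zero data stay zero forward -/

/-- **Forward vanishing of the differential for the flat wave equation** (domain of dependence
by the energy method): `v ∈ C²(ℝ⁴)`, `∑_μ ∂_μ(η^{μν}∂_ν v) = 0`, `Dv = 0` on `{x⁰ = 0}` ⇒
`Dv = 0` on `{x⁰ ≥ 0}` — Hawking–Ellis's conservation theorem in weighted form
(`KerrSchild.Background.fderiv_eq_zero_of_weight`) on the Minkowski background with the weight
`χ(2x⁰ + 2) · χ(R − x⁰ − (1 + ‖x⃗ − y⃗₀‖²)^{1/2})`, `R = x⁰₀ + 2`, whose flux sign is the dominant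
energy condition for the cone conormal `dt + n⃗·dx⃗`, `|n⃗| < 1`.
[cite: HawkingEllis1973CUP, §4.3 (the conservation theorem)] -/
theorem fderiv_eq_zero_of_flat_forward {v : E4 → ℝ} (hv : ContDiff ℝ 2 v)
    (hsol : ∀ x, KerrSchild.waveOperator KerrSchild.Background.minkowski.inverseMetric v x = 0)
    (hdata : ∀ x : E4, x 0 = 0 → fderiv ℝ v x = 0) {x : E4} (hx : 0 ≤ x 0) :
    fderiv ℝ v x = 0 := by
  set B := KerrSchild.Background.minkowski with hB
  set t₀ : ℝ := x 0 with ht₀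
  set y₀ : E3 := E4.spatial x with hy₀
  set R : ℝ := t₀ + 2 with hR
  -- ### the weight and its (compact) support
  set q₁ : E4 → ℝ := fun w ↦ R - w 0 - √((1 : ℝ) ^ 2 + ‖E4.spatial w - y₀‖ ^ 2) with hq₁
  set W : E4 → ℝ := fun w ↦ Real.smoothTransition (2 * w 0 + 2) * Real.smoothTransition (q₁ w)
    with hW
  have hW1 : ContDiff ℝ 1 W := contDiff_slabTimeCutoff.mul
    (Real.smoothTransition.contDiff.comp (contDiff_coneArg one_ne_zero R y₀))
  have hW0 : ∀ w, 0 ≤ W w := fun w ↦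
    mul_nonneg (Real.smoothTransition.nonneg _) (Real.smoothTransition.nonneg _)
  have hWsupp : ∀ w, W w ≠ 0 → -1 < w 0 ∧ ‖E4.spatial w - y₀‖ < R - w 0 := by
    intro w hw
    obtain ⟨h1, h2⟩ := mul_ne_zero_iff.mp hw
    refine ⟨neg_one_lt_of_slabTimeCutoff_ne_zero h1, ?_⟩
    have hq : 0 < q₁ w := by
      by_contra hle
      exact h2 (Real.smoothTransition.zero_of_nonpos (not_lt.mp hle))
    have := norm_le_sqrt_sq_add_norm_sq 1 (E4.spatial w - y₀)
    rw [hq₁] at hq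
    dsimp only at hq
    linarith
  set K : Set E4 := (fun q : ℝ × E3 ↦ E4.ofTimeSpace q.1 q.2) ''
    (Set.Icc (-1) R ×ˢ closedBall y₀ (R + 1)) with hK
  have hKc : IsCompact K :=
    (isCompact_Icc.prod (isCompact_closedBall y₀ (R + 1))).image E4.continuous_ofTimeSpace_uncurry
  have hWK : ∀ w, W w ≠ 0 → w ∈ K := by
    intro w hw
    obtain ⟨h1, h2⟩ := hWsupp w hw
    have hn : 0 ≤ ‖E4.spatial w - y₀‖ := norm_nonneg _
    refine ⟨(w 0, E4.spatial w), ⟨⟨h1.le, by linarith⟩, ?_⟩, E4.ofTimeSpace_time_spatial w⟩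
    rw [mem_closedBall, dist_eq_norm]
    linarith
  -- ### the flux condition (dominant energy condition for the cone conormal)
  have hflux : ∀ w ∈ K, 0 ≤ w 0 → w 0 ≤ t₀ →
      ∑ μ, fderiv ℝ W w (E4.basisVector μ) *
        KerrSchild.normalCurrent B.inverseMetric v w μ ≤ 0 := by
    intro w _ hw0 _
    set P : Fin 4 → ℝ := fun μ ↦ KerrSchild.normalCurrent B.inverseMetric v w μ with hP
    have hWev : W =ᶠ[𝓝 w] fun w' ↦
        Real.smoothTransition (q₁ w') * Real.smoothTransition ((fun _ : E4 ↦ (2 : ℝ)) w') := by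
      filter_upwards [slabTimeCutoff_eventuallyEq_one (show -2⁻¹ < w 0 by linarith)]
        with w' hw'
      rw [hW]
      dsimp only
      rw [hw', one_mul, Real.smoothTransition.one_of_one_le (by norm_num : (1 : ℝ) ≤ 2),
        mul_one]
    have hq₁d : DifferentiableAt ℝ q₁ w :=
      (coneArg_hasFDerivAt one_ne_zero R y₀ w).differentiableAt
    refine sum_fderiv_smoothTransition_mul_le P hWev hq₁d (differentiableAt_const _) ?_
      (Or.inl (deriv_smoothTransition_eq_zero_of_one_lt one_lt_two))
    obtain ⟨hν0, hn⟩ := coneArg_covector one_ne_zero R y₀ w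
    have hc := B.coneCovector_causal w (fun μ ↦ -fderiv ℝ q₁ w (E4.basisVector μ)) hν0 hn
    have hpos := B.sum_mul_normalCurrent_nonneg v w
      (fun μ ↦ -fderiv ℝ q₁ w (E4.basisVector μ)) hc.1 hc.2
    have hsum : ∑ μ, fderiv ℝ q₁ w (E4.basisVector μ) * P μ =
        -∑ μ, -fderiv ℝ q₁ w (E4.basisVector μ) *
          KerrSchild.normalCurrent B.inverseMetric v w μ := by
      rw [← Finset.sum_neg_distrib]
      exact Finset.sum_congr rfl fun μ _ ↦ by rw [hP]; ring
    rw [hsum]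
    linarith
  -- ### data, the weight at `x`, conclusion
  have hdataW : ∀ w, w 0 = 0 → W w ≠ 0 → fderiv ℝ v w = 0 := fun w hw0 _ ↦ hdata w hw0
  have hWx : W x ≠ 0 := by
    refine mul_ne_zero (Real.smoothTransition.pos_of_pos (by linarith)).ne'
      (Real.smoothTransition.pos_of_pos ?_).ne'
    have h1 : √((1 : ℝ) ^ 2 + ‖E4.spatial x - y₀‖ ^ 2) = 1 := by
      rw [hy₀, sub_self, norm_zero, zero_pow two_ne_zero, add_zero, one_pow, Real.sqrt_one]
    rw [hq₁]
    dsimp only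
    rw [h1]
    linarith
  exact B.fderiv_eq_zero_of_weight (U := Set.univ) hKc (Set.subset_univ K)
    (fun z _ ↦ hv.contDiffAt) hW1 hW0 hWK (fun w _ ↦ hsol w) hflux hdataW hx le_rfl hWx

/-! ## §5 Forward energy uniqueness on the flat member of the class -/

/-- For `r₀ < 0` the presentation cylinder `{r₀ < r(a,·)}` is all of `E4` (`r ≥ 0`). [folklore] -/
theorem setOf_lt_radius_eq_univ (a : ℝ) {r₀ : ℝ} (h : r₀ < 0) :
    {x : E4 | r₀ < Kerr.radius a x} = Set.univ :=
  Set.eq_univ_of_forall fun x ↦ h.trans_le (Kerr.radius_nonneg a x)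

/-- **Forward energy uniqueness on the flat member** (`G ≡ η`, `r₀ < 0`, cylinder `= E4`): a
`C²` solution of `□_η u = 0` (the line's `boxAt (fun _ ↦ η) u = 0`, unfolded) with
`E₁[u](t₁) = ∫ ∑_μ (∂_μ u)²(t₁, y) dy = 0` has `E₁[u](t) = 0` for every `t ≥ t₁` (§3 ⇒
`Du(t₁,·) = 0`; translate `v = u(· + t₁∂₀)`; §4 ⇒ `Dv = 0` on `{x⁰ ≥ 0}`; §3).  True backward
too on the flat member (time reflection), but only forward on black-hole members (the collar is
an outflow boundary forward). [cite: HawkingEllis1973CUP, §4.3 (the conservation theorem)] -/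
theorem flat_sliceEnergy_eq_zero_forward (a : ℝ) {r₀ : ℝ} (hr₀ : r₀ < 0) {u : E4 → ℝ}
    (hu : ContDiffOn ℝ 2 u {x : E4 | r₀ < Kerr.radius a x})
    (hbox : ∀ x ∈ {x : E4 | r₀ < Kerr.radius a x},
      MetricCoord.mtrAt (fun _ : E4 ↦ Minkowski.bilin) x (fderiv ℝ (fderiv ℝ u) x) -
        fderiv ℝ u x (∑ β : Fin 4, MetricCoord.chrAt (fun _ : E4 ↦ Minkowski.bilin) x
          (MetricCoord.sharpAt (fun _ : E4 ↦ Minkowski.bilin) x (E4.dx β)) (E4.basisVector β))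
        = 0)
    {t₁ t : ℝ} (ht : t₁ ≤ t)
    (h₁ : (∫⁻ y in {y : E3 | E4.ofTimeSpace t₁ y ∈ {x : E4 | r₀ < Kerr.radius a x}},
      ENNReal.ofReal
        (∑ μ : Fin 4, (fderiv ℝ u (E4.ofTimeSpace t₁ y) (E4.basisVector μ)) ^ 2)) = 0) :
    (∫⁻ y in {y : E3 | E4.ofTimeSpace t y ∈ {x : E4 | r₀ < Kerr.radius a x}},
      ENNReal.ofReal
        (∑ μ : Fin 4, (fderiv ℝ u (E4.ofTimeSpace t y) (E4.basisVector μ)) ^ 2)) = 0 := by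
  have hcyl := setOf_lt_radius_eq_univ a hr₀
  have hu' : ContDiff ℝ 2 u := by
    rw [hcyl] at hu
    exact contDiffOn_univ.mp hu
  have hC1 : ContDiffOn ℝ 1 u {x : E4 | r₀ < Kerr.radius a x} := hu.of_le (by norm_num)
  -- `Du(t₁, ·) = 0`
  have hD₁ : ∀ y : E3, fderiv ℝ u (E4.ofTimeSpace t₁ y) = 0 := fun y ↦
    (sliceEnergy_eq_zero_iff a r₀ hC1 t₁).mp h₁ y (by rw [hcyl]; trivial)
  -- the translate `v = u(· + t₁ ∂₀)` (`(s, y) + t₁ ∂₀ = (s + t₁, y)`)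
  have key : ∀ (s : ℝ) (y : E3),
      E4.ofTimeSpace s y + t₁ • E4.basisVector 0 = E4.ofTimeSpace (s + t₁) y := fun s y ↦ by
    rw [E4.ofTimeSpace_eq_smul_add', E4.ofTimeSpace_eq_smul_add', add_smul]; abel
  set v : E4 → ℝ := fun z ↦ u (z + t₁ • E4.basisVector 0) with hv
  have hvC : ContDiff ℝ 2 v := hu'.comp (contDiff_id.add contDiff_const)
  have hvD : ∀ z, DifferentiableAt ℝ (fderiv ℝ v) z := fun z ↦
    (hvC.fderiv_right (m := 1) (by norm_num)).differentiable (by norm_num) z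
  have hsol : ∀ z,
      KerrSchild.waveOperator KerrSchild.Background.minkowski.inverseMetric v z = 0 := by
    intro z
    rw [waveOperator_minkowski_eq_boxAt (hvD z), hv, flatBox_comp_add_right]
    exact hbox _ (by rw [hcyl]; trivial)
  have hdata : ∀ z : E4, z 0 = 0 → fderiv ℝ v z = 0 := by
    intro z hz
    rw [hv, fderiv_comp_add_right, ← Kerr.ofTimeSpace_spatial_eq hz, key, zero_add]
    exact hD₁ _
  -- `Du(t, ·) = 0` for `t ≥ t₁`, hence `E₁(t) = 0`
  refine (sliceEnergy_eq_zero_iff a r₀ hC1 t).mpr fun y _ ↦ ?_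
  have h := fderiv_eq_zero_of_flat_forward hvC hsol hdata (x := E4.ofTimeSpace (t - t₁) y)
    (by simp; linarith)
  rwa [hv, fderiv_comp_add_right, key, sub_add_cancel] at h

/-! ## §6 The registered sub-goals of `stub_trappedSetObservability` (S4 v2) -/

/-- Registered sub-goal `stub_boxAtMinkowskiEqWaveOperator` of `stub_trappedSetObservability`
(S4 v2): **the line's `□_η` (`boxAt (fun _ ↦ η)`, unfolded) is the tree's flat divergence-form
wave operator `KerrSchild.waveOperator minkowski.inverseMetric`** wherever `Du` is
differentiable. [cite: ONeill1983, Ch. 3, Lemma 3.36] -/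
theorem stub_boxAtMinkowskiEqWaveOperator :
    ∀ (u : E4 → ℝ) (x : E4), DifferentiableAt ℝ (fderiv ℝ u) x → MetricCoord.mtrAt (fun _ : E4 ↦ Minkowski.bilin) x (fderiv ℝ (fderiv ℝ u) x) - fderiv ℝ u x (∑ β : Fin 4, MetricCoord.chrAt (fun _ : E4 ↦ Minkowski.bilin) x (MetricCoord.sharpAt (fun _ : E4 ↦ Minkowski.bilin) x (E4.dx β)) (E4.basisVector β)) = KerrSchild.waveOperator (KerrSchild.Background.minkowski).inverseMetric u x :=
  fun _ _ hu ↦ (waveOperator_minkowski_eq_boxAt hu).symm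

/-- Registered sub-goal `stub_sliceEnergyEqZeroIff` of `stub_trappedSetObservability` (S4 v2):
**on every presentation cylinder (any `a`, any sign of `r₀`), for `u ∈ C¹` on it, the slice
energy `E₁[u](t)` vanishes iff `Du = 0` on the slice `{x⁰ = t}` of the cylinder** (the line's
`sliceEnergy a r₀ u t = 0 ↔ ∀ y, (t,y) ∈ cyl a r₀ → Du(t,y) = 0`, unfolded). [folklore] -/
theorem stub_sliceEnergyEqZeroIff :
    ∀ (a r₀ : ℝ) (u : E4 → ℝ), ContDiffOn ℝ 1 u {x : E4 | r₀ < Kerr.radius a x} → ∀ t : ℝ, (∫⁻ y in {y : E3 | E4.ofTimeSpace t y ∈ {x : E4 | r₀ < Kerr.radius a x}}, ENNReal.ofReal (∑ μ : Fin 4, (fderiv ℝ u (E4.ofTimeSpace t y) (E4.basisVector μ)) ^ 2)) = 0 ↔ ∀ y : E3, E4.ofTimeSpace t y ∈ {x : E4 | r₀ < Kerr.radius a x} → fderiv ℝ u (E4.ofTimeSpace t y) = 0 :=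
  fun a r₀ _ hu t ↦ sliceEnergy_eq_zero_iff a r₀ hu t

/-- Registered sub-goal `stub_flatForwardEnergyUniqueness` of `stub_trappedSetObservability`
(S4 v2) — **THE FIRST RUNG on the flat member** (`r₀ < 0`, cylinder `= E4`, `G ≡ η`): every `C²`
solution of the line's `boxAt (fun _ ↦ η) u = 0` with `sliceEnergy a r₀ u t₁ = 0` has
`sliceEnergy a r₀ u t = 0` for all `t ≥ t₁` (vocabulary unfolded verbatim).
[cite: HawkingEllis1973CUP, §4.3 (the conservation theorem)] -/
theorem stub_flatForwardEnergyUniqueness :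
    ∀ (a r₀ : ℝ), r₀ < 0 → ∀ u : E4 → ℝ, ContDiffOn ℝ 2 u {x : E4 | r₀ < Kerr.radius a x} → (∀ x ∈ {x : E4 | r₀ < Kerr.radius a x}, MetricCoord.mtrAt (fun _ : E4 ↦ Minkowski.bilin) x (fderiv ℝ (fderiv ℝ u) x) - fderiv ℝ u x (∑ β : Fin 4, MetricCoord.chrAt (fun _ : E4 ↦ Minkowski.bilin) x (MetricCoord.sharpAt (fun _ : E4 ↦ Minkowski.bilin) x (E4.dx β)) (E4.basisVector β)) = 0) → ∀ t₁ t : ℝ, t₁ ≤ t → (∫⁻ y in {y : E3 | E4.ofTimeSpace t₁ y ∈ {x : E4 | r₀ < Kerr.radius a x}}, ENNReal.ofReal (∑ μ : Fin 4, (fderiv ℝ u (E4.ofTimeSpace t₁ y) (E4.basisVector μ)) ^ 2)) = 0 → (∫⁻ y in {y : E3 | E4.ofTimeSpace t y ∈ {x : E4 | r₀ < Kerr.radius a x}}, ENNReal.ofReal (∑ μ : Fin 4, (fderiv ℝ u (E4.ofTimeSpace t y) (E4.basisVector μ)) ^ 2)) = 0 :=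
  fun a _ hr₀ _ hu hbox _ _ ht h₁ ↦ flat_sliceEnergy_eq_zero_forward a hr₀ hu hbox ht h₁

end Summit.FinalStateConjecture.FinalStateConjecture.Theorems.TrappedSet

end
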